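import Summits.QuantumFields.YangMills.Theorems.SourcedPressureJensenSourcedPressureDecouplingDefs
import Summits.QuantumFields.YangMills.Theorems.SourcedPressureJensenColdBoxSourcedPressureDefs
import Summits.QuantumFields.YangMills.Theorems.SourcedPressureJensenSourcedPressureDecouplingTranslationAverage
import HarnessLib

/-!
# Route `SourcedPressureJensen`, crux `SourcedPressureDecoupling` (KS2″, stmt-QuantumFields-24296), line «ENTROPIC-SEAM»,
# stub `stub_chain` — part 2: TRANSLATION-AVERAGED JENSEN onto the interior pairs of the cell tiling

With the objects of `…SourcedPressureDecouplingDefs` (KS2″: `incrT`, `intCard`, `mT`) and `…ColdBoxSourcedPressureDefs` (KS1″: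
`cellSource`): the torus sourced increment is dominated by the sourced exponential moment of the INTERIOR pairs of the tiling by cells
`a + [0,ℓ]⁴`, `a ∈ (ℓ+1)·{0,…,q−1}⁴`, `q = (L+1)/(ℓ+1)`, at the rescaled strength `h′ = h·(L+1)⁴/intCard`:

* `sum_interiorPairs_eq_sum_cells` — the interior-pair sum is the sum over cells of the cell sums: for every `F`,
  `Σ_{y ∈ P} F y = Σ_{a ∈ A} Σ_{x ∈ P₀} F (x + a)` (`P` = the filter defining `intCard`, `P₀` = the filter of `cellSource`, `A` = cell base
  points; the bijection `(a, x) ↦ x + a`, no wrap-around);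
* `sum_cellPairs_translate_eq_cellSource` — `Σ_{x∈P₀} H_{x+a}(U) = cellSource r β m ℓ n L (τ_a U)` with `τ_a` the torus shift by `a`
  (`translate_add_apply`);
* `incrT_le_log_cells` — **`incrT r β h n L ≤ ((L+1)⁴)⁻¹ · log E_T[exp(−h′ · Σ_{a∈A} cellSource r β m_T ℓ n L ∘ τ_a)]`**
  (`translationAveraged_jensen` with `P` = interior pairs, then the two identities above).

What remains for `stub_chain` after parts 1–2: the product structure of `μ_T.tilted(β·S_seam)` over the cells (each factor = the free
cell state; `integral_zdHaar_mul_eq_of_dependsOn` + `integral_torusLift_eq_integral_zdHaar`).  Everything here is proved; no definition,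
no named fact.  RECORD-label rung support; the Yang–Mills mass gap is NOT proved by anything here. [folklore]
-/

set_option autoImplicit false

noncomputable section

open MeasureTheory Real Finset
open Literature.MathematicalPhysics.QuantumFieldTheory Literature.MathematicalPhysics.QuantumLattice
open Literature.Probability.LatticeModels
open Summit.QuantumFields.YangMills.Theorems.WeakCouplingRates
open Summit.QuantumFields.YangMills.Cruxes.ColdBoxSourcedPressure.Birth
open Summit.QuantumFields.YangMills.Theorems.SourcedPressureJensen

namespace Summit.QuantumFields.YangMills.Cruxes.SourcedPressureDecoupling.EntropicSeam

/-! ### Tiling combinatorics on `(Fin (L+1))⁴`: interior pairs = cells × cell pairs -/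

section Tiling

variable {L : ℕ}

/-- No wrap-around: for `x k ≤ ℓ` and `a k` a multiple of `ℓ+1` below `q(ℓ+1) ≤ L+1`, the `Fin (L+1)`-sum `x k + a k` has value
`x k + a k`. [folklore] -/
theorem val_add_eq_of_cell (ℓ : ℕ) {x a : Fin 4 → Fin (L + 1)} (k : Fin 4) (hx : (x k : ℕ) ≤ ℓ)
    (ha : (a k : ℕ) % (ℓ + 1) = 0 ∧ (a k : ℕ) < (L + 1) / (ℓ + 1) * (ℓ + 1)) :
    (((x + a) k : Fin (L + 1)) : ℕ) = (x k : ℕ) + (a k : ℕ) := by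
  rw [Pi.add_apply, Fin.val_add]
  apply Nat.mod_eq_of_lt
  have hq : (L + 1) / (ℓ + 1) * (ℓ + 1) ≤ L + 1 := Nat.div_mul_le_self _ _
  obtain ⟨c, hc⟩ : (ℓ + 1) ∣ (a k : ℕ) := Nat.dvd_of_mod_eq_zero ha.1
  have hc' : c < (L + 1) / (ℓ + 1) := by
    have h1 := ha.2; rw [hc] at h1
    have h2 : c * (ℓ + 1) < (L + 1) / (ℓ + 1) * (ℓ + 1) := by rwa [mul_comm] at h1
    exact Nat.lt_of_mul_lt_mul_right h2
  have : (a k : ℕ) + (ℓ + 1) ≤ (L + 1) / (ℓ + 1) * (ℓ + 1) := by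
    rw [hc]
    calc (ℓ + 1) * c + (ℓ + 1) = (c + 1) * (ℓ + 1) := by ring
      _ ≤ (L + 1) / (ℓ + 1) * (ℓ + 1) := Nat.mul_le_mul_right _ hc'
  omega

/-- **Interior pairs = cells × cell pairs**: for every `F`,
`Σ_{y ∈ P} F y = Σ_{a ∈ A} Σ_{x ∈ P₀} F (x + a)`, where `P` is the interior-pair filter of `intCard`, `P₀` the pair filter of `cellSource`
(cell `[0,ℓ]⁴`) and `A` the set of cell base points (all coordinates multiples of `ℓ+1` below `q(ℓ+1)`). [folklore] -/
theorem sum_interiorPairs_eq_sum_cells (n ℓ : ℕ) (F : (Fin 4 → Fin (L + 1)) → ℝ) :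
    ∑ y ∈ Finset.univ.filter (fun x : Fin 4 → Fin (L + 1) => ((∀ k : Fin 4, ((x k : ℕ)) < ((L + 1) / (ℓ + 1)) * (ℓ + 1)) ∧
        ((x 1 : ℕ)) % (ℓ + 1) ≠ ℓ ∧ ((x 2 : ℕ)) % (ℓ + 1) ≠ ℓ ∧ ((x 0 : ℕ)) % (ℓ + 1) + n ≤ ℓ)), F y =
      ∑ a ∈ Finset.univ.filter (fun a : Fin 4 → Fin (L + 1) =>
          ∀ k : Fin 4, ((a k : ℕ)) % (ℓ + 1) = 0 ∧ ((a k : ℕ)) < ((L + 1) / (ℓ + 1)) * (ℓ + 1)),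
        ∑ x ∈ Finset.univ.filter (fun x : Fin 4 → Fin (L + 1) =>
            ((∀ k : Fin 4, ((x k : ℕ)) ≤ ℓ) ∧ ((x 1 : ℕ)) + 1 ≤ ℓ ∧ ((x 2 : ℕ)) + 1 ≤ ℓ ∧ ((x 0 : ℕ)) + n ≤ ℓ)),
          F (x + a) := by
  classical
  set q : ℕ := (L + 1) / (ℓ + 1) with hq
  have hqL : q * (ℓ + 1) ≤ L + 1 := Nat.div_mul_le_self _ _
  set P : Finset (Fin 4 → Fin (L + 1)) := Finset.univ.filter (fun x : Fin 4 → Fin (L + 1) =>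
    ((∀ k : Fin 4, ((x k : ℕ)) < q * (ℓ + 1)) ∧ ((x 1 : ℕ)) % (ℓ + 1) ≠ ℓ ∧ ((x 2 : ℕ)) % (ℓ + 1) ≠ ℓ ∧
      ((x 0 : ℕ)) % (ℓ + 1) + n ≤ ℓ)) with hP
  set A : Finset (Fin 4 → Fin (L + 1)) := Finset.univ.filter (fun a : Fin 4 → Fin (L + 1) =>
    ∀ k : Fin 4, ((a k : ℕ)) % (ℓ + 1) = 0 ∧ ((a k : ℕ)) < q * (ℓ + 1)) with hA
  set P₀ : Finset (Fin 4 → Fin (L + 1)) := Finset.univ.filter (fun x : Fin 4 → Fin (L + 1) =>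
    ((∀ k : Fin 4, ((x k : ℕ)) ≤ ℓ) ∧ ((x 1 : ℕ)) + 1 ≤ ℓ ∧ ((x 2 : ℕ)) + 1 ≤ ℓ ∧ ((x 0 : ℕ)) + n ≤ ℓ)) with hP₀
  -- the map `(a, x) ↦ x + a` on `A ×ˢ P₀`
  have hval : ∀ a ∈ A, ∀ x ∈ P₀, ∀ k : Fin 4, (((x + a) k : Fin (L + 1)) : ℕ) = (x k : ℕ) + (a k : ℕ) := by
    intro a ha x hx k
    simp only [hA, hP₀, mem_filter, mem_univ, true_and] at ha hx
    exact val_add_eq_of_cell ℓ k (hx.1 k) (ha k)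
  have hinj : Set.InjOn (fun p : (Fin 4 → Fin (L + 1)) × (Fin 4 → Fin (L + 1)) => p.2 + p.1) ↑(A ×ˢ P₀) := by
    rintro ⟨a, x⟩ hp ⟨a', x'⟩ hp' heq
    simp only [coe_product, Set.mem_prod, mem_coe] at hp hp'
    simp only at heq
    have hk : ∀ k : Fin 4, (x k : ℕ) + (a k : ℕ) = (x' k : ℕ) + (a' k : ℕ) := fun k => by
      rw [← hval a hp.1 x hp.2 k, ← hval a' hp'.1 x' hp'.2 k, heq]
    have ha := hp.1; have hx := hp.2; have ha' := hp'.1; have hx' := hp'.2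
    simp only [hA, hP₀, mem_filter, mem_univ, true_and] at ha hx ha' hx'
    -- uniqueness of the decomposition `y = x + a`, `x ≤ ℓ`, `(ℓ+1) ∣ a`
    have hxx : x = x' := by
      funext k; apply Fin.ext
      have h1 := hk k
      have hdx : (x k : ℕ) % (ℓ + 1) = x k := Nat.mod_eq_of_lt (by have := hx.1 k; omega)
      have hdx' : (x' k : ℕ) % (ℓ + 1) = x' k := Nat.mod_eq_of_lt (by have := hx'.1 k; omega)
      have := congrArg (· % (ℓ + 1)) h1
      simp only [Nat.add_mod, (ha k).1, (ha' k).1, add_zero, hdx, hdx'] at this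
      exact this
    subst hxx
    have haa : a = a' := by
      funext k; apply Fin.ext
      have := hk k; omega
    subst haa
    rfl
  have himage : (A ×ˢ P₀).image (fun p : (Fin 4 → Fin (L + 1)) × (Fin 4 → Fin (L + 1)) => p.2 + p.1) = P := by
    ext y
    simp only [mem_image, mem_product]
    constructor
    · rintro ⟨⟨a, x⟩, ⟨ha, hx⟩, rfl⟩
      have hv := hval a ha x hx
      simp only [hA, hP₀, hP, mem_filter, mem_univ, true_and] at ha hx ⊢
      have hmod : ∀ k, (((x + a) k : Fin (L + 1)) : ℕ) % (ℓ + 1) = (x k : ℕ) := fun k => by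
        rw [hv k, Nat.add_mod, (ha k).1, add_zero, Nat.mod_mod]
        exact Nat.mod_eq_of_lt (by have := hx.1 k; omega)
      refine ⟨fun k => ?_, ?_, ?_, ?_⟩
      · rw [hv k]
        obtain ⟨c, hc⟩ : (ℓ + 1) ∣ (a k : ℕ) := Nat.dvd_of_mod_eq_zero (ha k).1
        have hc' : c < q := by
          have h1 := (ha k).2; rw [hc] at h1
          have h2 : c * (ℓ + 1) < q * (ℓ + 1) := by rwa [mul_comm] at h1
          exact Nat.lt_of_mul_lt_mul_right h2
        have := hx.1 k
        calc (x k : ℕ) + (a k : ℕ) < (ℓ + 1) + (ℓ + 1) * c := by rw [hc]; omega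
          _ = (c + 1) * (ℓ + 1) := by ring
          _ ≤ q * (ℓ + 1) := Nat.mul_le_mul_right _ hc'
      · rw [hmod 1]; have := hx.2.1; omega
      · rw [hmod 2]; have := hx.2.2.1; omega
      · rw [hmod 0]; exact hx.2.2.2
    · intro hy
      simp only [hP, mem_filter, mem_univ, true_and] at hy
      -- `a k = (ℓ+1) (y k / (ℓ+1))`, `x k = y k % (ℓ+1)`
      refine ⟨⟨fun k => ⟨(ℓ + 1) * ((y k : ℕ) / (ℓ + 1)), ?_⟩, fun k => ⟨(y k : ℕ) % (ℓ + 1), ?_⟩⟩, ⟨?_, ?_⟩, ?_⟩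
      · exact lt_of_le_of_lt (Nat.mul_div_le _ _) (y k).isLt
      · exact lt_of_le_of_lt (Nat.mod_le _ _) (y k).isLt
      · simp only [hA, mem_filter, mem_univ, true_and]
        intro k
        refine ⟨by simp [Nat.mul_mod_right], ?_⟩
        calc (ℓ + 1) * ((y k : ℕ) / (ℓ + 1)) ≤ (y k : ℕ) := Nat.mul_div_le _ _
          _ < q * (ℓ + 1) := hy.1 k
      · simp only [hP₀, mem_filter, mem_univ, true_and]
        have hlt : ∀ k, (y k : ℕ) % (ℓ + 1) < ℓ + 1 := fun k => Nat.mod_lt _ (Nat.succ_pos ℓ)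
        refine ⟨fun k => Nat.le_of_lt_succ (hlt k), ?_, ?_, ?_⟩
        · show (y 1 : ℕ) % (ℓ + 1) + 1 ≤ ℓ
          have h1 := hy.2.1; have h2 := hlt 1; omega
        · show (y 2 : ℕ) % (ℓ + 1) + 1 ≤ ℓ
          have h1 := hy.2.2.1; have h2 := hlt 2; omega
        · show (y 0 : ℕ) % (ℓ + 1) + n ≤ ℓ
          exact hy.2.2.2
      · funext k
        apply Fin.ext
        rw [Pi.add_apply, Fin.val_add]
        simp only
        rw [Nat.mod_add_div (y k : ℕ) (ℓ + 1), Nat.mod_eq_of_lt (y k).isLt]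
  rw [← himage, Finset.sum_image hinj, Finset.sum_product]

end Tiling

/-! ### The cell sums are translates of `cellSource` -/

section Cells

variable {G : Type} [Group G] [TopologicalSpace G] [IsTopologicalGroup G] [CompactSpace G]
  [MeasurableSpace G] [BorelSpace G]

omit [IsTopologicalGroup G] [CompactSpace G] [BorelSpace G] in
/-- The pair sum of the cell translated by `a` is `cellSource` read on the configuration shifted by `a`:
`Σ_{x ∈ P₀} H_{x+a}(U) = cellSource r β m ℓ n L (τ_a U)`, `τ_a = torusConfigShift (proj(−â))`. [folklore] -/
theorem sum_cellPairs_translate_eq_cellSource (r : LatticeRep G) (β m : ℝ) (ℓ n L : ℕ) (a : Fin 4 → Fin (L + 1))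
    (U : GaugeConfig 4 (L + 1) G) :
    ∑ x ∈ Finset.univ.filter (fun x : Fin 4 → Fin (L + 1) =>
        ((∀ k : Fin 4, ((x k : ℕ)) ≤ ℓ) ∧ ((x 1 : ℕ)) + 1 ≤ ℓ ∧ ((x 2 : ℕ)) + 1 ≤ ℓ ∧ ((x 0 : ℕ)) + n ≤ ℓ)),
      toTorusObservable (L + 1) (fun V => (β * plaqCost0 (d := 4) r.ρ 1 2 (configShift (fun i => -(((x + a) i : ℕ) : ℤ)) V) - m) *
        (β * plaqCost0 (d := 4) r.ρ 1 2 (timeShiftLG (G := G) n (configShift (fun i => -(((x + a) i : ℕ) : ℤ)) V)) - m)) U =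
      cellSource r β m ℓ n L
        (Literature.MathematicalPhysics.QuantumFieldTheory.torusConfigShift (Torus.proj (L + 1) (fun i => -((a i : ℕ) : ℤ))) U) := by
  classical
  unfold cellSource
  rw [Finset.sum_filter]
  refine Finset.sum_congr rfl fun x _ => ?_
  split_ifs with hx
  · exact translate_add_apply L (fun V => (β * plaqCost0 (d := 4) r.ρ 1 2 V - m) *
      (β * plaqCost0 (d := 4) r.ρ 1 2 (timeShiftLG (G := G) n V) - m)) x a U
  · rfl

/-! ### Translation-averaged Jensen onto the cells -/

/-- **`incrT` is dominated by the sourced exponential moment of the interior pairs of the tiling, cell by cell**: with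
`q = (L+1)/(ℓ+1)`, `A` the cell base points and `h′ = h·(L+1)⁴/intCard n ℓ L` (requires `intCard ≠ 0`):
`incrT r β h n L ≤ ((L+1)⁴)⁻¹ · log E_T[exp(−h′ · Σ_{a∈A} cellSource r β m_T ℓ n L (τ_a ·))]`. [folklore] -/
theorem incrT_le_log_cells (r : LatticeRep G) (β h : ℝ) (n ℓ L : ℕ) (hI : 0 < intCard n ℓ L) :
    incrT r β h n L ≤ ((L + 1 : ℝ) ^ 4)⁻¹ * Real.log (wilsonExpectation (L := L + 1) r.ρ β fun U =>
      Real.exp (-(h * (L + 1 : ℝ) ^ 4 / (intCard n ℓ L : ℝ)) *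
        ∑ a ∈ Finset.univ.filter (fun a : Fin 4 → Fin (L + 1) =>
            ∀ k : Fin 4, ((a k : ℕ)) % (ℓ + 1) = 0 ∧ ((a k : ℕ)) < ((L + 1) / (ℓ + 1)) * (ℓ + 1)),
          cellSource r β (mT r β L) ℓ n L
            (Literature.MathematicalPhysics.QuantumFieldTheory.torusConfigShift
              (Torus.proj (L + 1) (fun i => -((a i : ℕ) : ℤ))) U))) := by
  classical
  -- the single-site source density with the torus centring
  set g : LGConfig 4 G → ℝ := fun V => (β * plaqCost0 (d := 4) r.ρ 1 2 V - mT r β L) *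
    (β * plaqCost0 (d := 4) r.ρ 1 2 (timeShiftLG (G := G) n V) - mT r β L) with hg
  have hgc : Continuous g := by
    have hc := (continuous_bounded_plaqCost0 (d := 4) r.ρ r.continuous 1 2).1
    simp only [hg]
    exact ((continuous_const.mul hc).sub continuous_const).mul
      ((continuous_const.mul (hc.comp (continuous_timeShiftLG n))).sub continuous_const)
  set P : Finset (Fin 4 → Fin (L + 1)) := Finset.univ.filter (fun x : Fin 4 → Fin (L + 1) =>
    ((∀ k : Fin 4, ((x k : ℕ)) < ((L + 1) / (ℓ + 1)) * (ℓ + 1)) ∧ ((x 1 : ℕ)) % (ℓ + 1) ≠ ℓ ∧ ((x 2 : ℕ)) % (ℓ + 1) ≠ ℓ ∧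
      ((x 0 : ℕ)) % (ℓ + 1) + n ≤ ℓ)) with hP
  have hPcard : P.card = intCard n ℓ L := rfl
  have hPne : P.Nonempty := Finset.card_pos.1 (by rw [hPcard]; exact hI)
  -- translation-averaged Jensen with `c = −h`
  have hJ := translationAveraged_jensen r β L hgc (-h) P hPne
  -- rewrite both sides
  have hlhs : (fun U : GaugeConfig 4 (L + 1) G => Real.exp (-h * ∑ x : Fin 4 → Fin (L + 1),
      toTorusObservable (L + 1) (fun V => g (configShift (fun i => -((x i : ℕ) : ℤ)) V)) U)) =
      fun U => Real.exp (-h * ∑ x : Fin 4 → Fin (L + 1), toTorusObservable (L + 1) (fun V =>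
        (β * plaqCost0 (d := 4) r.ρ 1 2 (configShift (fun i => -((x i : ℕ) : ℤ)) V) -
            β * wilsonExpectation (L := L + 1) r.ρ β (toTorusObservable (L + 1) (plaqCost0 (d := 4) r.ρ 1 2))) *
          (β * plaqCost0 (d := 4) r.ρ 1 2 (timeShiftLG (G := G) n (configShift (fun i => -((x i : ℕ) : ℤ)) V)) -
            β * wilsonExpectation (L := L + 1) r.ρ β (toTorusObservable (L + 1) (plaqCost0 (d := 4) r.ρ 1 2)))) U) := by
    rfl
  have hrhs : ∀ U : GaugeConfig 4 (L + 1) G,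
      (-h * (L + 1 : ℝ) ^ 4 / P.card) * ∑ y ∈ P, toTorusObservable (L + 1) (fun V => g (configShift (fun i => -((y i : ℕ) : ℤ)) V)) U =
      -(h * (L + 1 : ℝ) ^ 4 / (intCard n ℓ L : ℝ)) *
        ∑ a ∈ Finset.univ.filter (fun a : Fin 4 → Fin (L + 1) =>
            ∀ k : Fin 4, ((a k : ℕ)) % (ℓ + 1) = 0 ∧ ((a k : ℕ)) < ((L + 1) / (ℓ + 1)) * (ℓ + 1)),
          cellSource r β (mT r β L) ℓ n L
            (Literature.MathematicalPhysics.QuantumFieldTheory.torusConfigShift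
              (Torus.proj (L + 1) (fun i => -((a i : ℕ) : ℤ))) U) := by
    intro U
    rw [hPcard, hP, sum_interiorPairs_eq_sum_cells n ℓ
      (fun y => toTorusObservable (L + 1) (fun V => g (configShift (fun i => -((y i : ℕ) : ℤ)) V)) U)]
    congr 1
    · ring
    · refine Finset.sum_congr rfl fun a _ => ?_
      exact sum_cellPairs_translate_eq_cellSource r β (mT r β L) ℓ n L a U
  unfold incrT
  have hN : 0 ≤ ((L + 1 : ℝ) ^ 4)⁻¹ := by positivity
  refine mul_le_mul_of_nonneg_left ?_ hN
  rw [hlhs] at hJ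
  refine hJ.trans (le_of_eq ?_)
  congr 1
  congr 1
  funext U
  rw [hrhs U]

end Cells

end Summit.QuantumFields.YangMills.Cruxes.SourcedPressureDecoupling.EntropicSeam

end
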